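import Mathlib
import HarnessLib
import Summits.ResolutionOfSingularities.ResolutionOfSingularities.Theorems.WildQuotientsWildQuotientResolutionS1aBlowupNodeAtlas
import Summits.ResolutionOfSingularities.ResolutionOfSingularities.Theorems.WildQuotientsWildQuotientResolutionS1aKillableOfChartData
import Summits.ResolutionOfSingularities.ResolutionOfSingularities.Theorems.WildQuotientsWildQuotientResolutionS1aKillCentreGood

/-!
# S1a — THE NODE RING OF A BLOW-UP CHART, EXPOSED: second-level RING data on the charts `D₊(y_j t)` of a weighted blow-up give `KillableAt` over the centre chart

[OURS · L1 W4.5c · lead-1 g9; plan-1 g12 RULING 10:56:19Z priority (d), second half] — NOT statements of the manuscript; counted 0; AI-level work, weaker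
than expert review. Crux stmt-ResolutionOfSingularities-17941, line `s1a-logminvertex` v10; the bridge from chart-level (census) certificates to the
killability clause of `AuxChartsAt` / `AuxOrbitAt` / `AuxTopAt`. Route-independent.

`exists_isNodeChart_of_isCentreChart` (p585578) proves that over a CENTRE chart `O` (node `(B, 𝒜, σ, e)`, centre `(f, w)`) the blow-up is covered by node
charts, but hides WHICH charts and WHICH node rings inside an `∃`. Here the σ-invariant normalised cover `y_j ∈ K_{dk}` is an INPUT and the conclusion
is explicit: the chart is `W_j = V′[O, e⁻¹ y_j]` (`blowupChart`), its node ring is `ChartRing 𝒜 f w (dk) y_j`, its grading `chartNodeGrading` (= `reindex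
(chartGrading …) (consIndexEquiv r)`), its automorphism `sigmaChart …`, for ANY equivariant action upstairs (`hcomm`), so for every move of the game.
* `RingKillData p r B 𝒜 σ` — CENTRE + KILL data in a given node ring (the part of `IsPrincipalChartData` after the node; what a second-level certificate is);
  `isPrincipalChartData_of_ringKillData` (node chart data + ring kill data ⇒ principal chart data);
* ★ `exists_stable_blowupChart` — `W_j` is a stable affine open (affine, affine over the base, `G`-stable) of any equivariant action upstairs;
  ★★ `exists_nodeData_blowupChart` — … with the EXPLICIT node `(ChartRing, chartNodeGrading, sigmaChart, E)`, tame, and `E` intertwining `g₀`;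
  `iSup_blowupChart_eq_preimage` — the `W_j` cover `π⁻¹ O`;
* ★★ `GameFrame.GModel.killableAt_over_of_ringKillData` — for a move `M → M′` along `(𝒦, d)`, a centre chart `O` of `𝒦` with explicit node/centre data, a
  σ-invariant normalised cover `(k, y)` and RING KILL DATA on every `ChartRing 𝒜 f w (dk) y_j`: every point of `M′` over `O` is `KillableAt`
  (`killableAt_of_chartData`, p627540).
-/

set_option linter.dupNamespace false

noncomputable section

open CategoryTheory AlgebraicGeometry TopologicalSpace Polynomial
open Literature.AlgebraicGeometry.Resolution Literature.AlgebraicGeometry.RelativeSpec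
open Summit.ResolutionOfSingularities.ResolutionOfSingularities.Theorems.WildQuotientResolution.S1
open Summit.ResolutionOfSingularities.ResolutionOfSingularities.Theorems.WildQuotientResolution.S1.ProducerStep
open Summit.ResolutionOfSingularities.ResolutionOfSingularities.Theorems.WildQuotientResolution.S1.CoarseChart
open Summit.ResolutionOfSingularities.ResolutionOfSingularities.Theorems.WildQuotientResolution.S1.NodeAtlas
open Summit.ResolutionOfSingularities.ResolutionOfSingularities.Theorems.WildQuotientResolution.S1.MoveStep
open Summit.ResolutionOfSingularities.ResolutionOfSingularities.Theorems.WildQuotientResolution.BlowupExit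

namespace Summit.ResolutionOfSingularities.ResolutionOfSingularities.Theorems.WildQuotientResolution.S1.BlowupCharts

universe u

/-! ## Ring kill data in a node -/

section RingData

/-- **RING KILL DATA** in a node `(B, 𝒜, σ)` graded by `Π j : Fin m, ZMod (r j)`: a K1′-regular σ-adapted homogeneous weighted centre `(f, δ, w)` with
`0 < c`, a Veronese degree `d` of its degree-0 trace, and the KILL clause — principal augmentation ideal of `sigmaChart` on every σ-invariant chart of the
weighted blow-up. The node-free part of `NodeAtlas.IsPrincipalChartData`; this is what a (second-level) kill certificate supplies. [OURS · L1 W4.5c] -/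
def RingKillData (p : ℕ) {m : ℕ} (r : Fin m → ℕ) (B : Type u) [CommRing B] (𝒜 : (Π j : Fin m, ZMod (r j)) → AddSubgroup B) [GradedRing 𝒜]
    (σ : B ≃+* B) : Prop :=
  ∃ (c : ℕ) (f : Fin c → B) (δ : Fin c → Π j : Fin m, ZMod (r j)) (w : Fin c → ℕ) (d : ℕ),
    0 < c ∧ (∀ i, f i ∈ 𝒜 (δ i)) ∧ (∀ i, 0 < w i) ∧
    RingTheory.Sequence.IsRegular B (List.ofFn f) ∧ IsRegularRing (B ⧸ Ideal.span (Set.range f)) ∧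
    ∃ (hσJ : ∀ n : ℕ, ((weightedFiltration f w).ideal n).map (σ : B →+* B) ≤ (weightedFiltration f w).ideal n),
      CoarseChart.VeroneseNormalised 𝒜 f w d ∧
      ∀ (hp : 0 < p) (hσp : ∀ x : B, (⇑σ)^[p] x = x) (d' : ℕ) (b : ↥(𝒜 0))
        (hb : b ∈ (CoarseChart.traceFiltration 𝒜 f w).ideal d') (hσb : σ (b : B) = b), 0 < d' →
        (augmentationIdeal (CoarseChart.sigmaChart 𝒜 f w d' b hb σ hσJ hp hσp hσb)).IsPrincipal

variable {p : ℕ} {V Y : Scheme.{u}} {q : V ⟶ Y} {G : Type u} [Group G] {ρ : ActionOver q G} {g₀ : G}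

/-- **Node chart data + ring kill data ⇒ principal chart data.** [OURS · L1 W4.5c] -/
theorem isPrincipalChartData_of_ringKillData {O : ρ.StableAffineOpens} (hO : IsAffineOpen O.1) {m : ℕ} (r : Fin m → ℕ) (B : Type u)
    [CommRing B] (𝒜 : (Π j : Fin m, ZMod (r j)) → AddSubgroup B) [GradedRing 𝒜] (σ : B ≃+* B) (e : Γ(V, O.1) ≃+* ↥(𝒜 0))
    (htame : IsTameNode p B 𝒜 σ)
    (hσ : ∀ t : Γ(V, O.1), ((e ((ρ.aut g₀⁻¹).hom.appLE O.1 O.1 (O.2.1 g₀⁻¹).ge t) : ↥(𝒜 0)) : B) = σ ((e t : ↥(𝒜 0)) : B))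
    (hdata : RingKillData p r B 𝒜 σ) : ∃ d, IsPrincipalChartData p ρ g₀ d O := by
  obtain ⟨c, f, δ, w, d, hc, hf, hw, hK1, hK1', hσJ, hver, hprin⟩ := hdata
  exact ⟨d, hO, m, r, B, inferInstance, 𝒜, inferInstance, σ, e, htame, hσ, c, f, δ, w, hc, hf, hw, hK1, hK1', hσJ, hver, hprin⟩

end RingData

/-! ## The node of a blow-up chart, exposed -/

section Centre

variable {V' V Y : Scheme.{u}} {π : V' ⟶ V} {q : V ⟶ Y} {I : V.IdealSheafData} {G : Type u} [Group G]
  (ρ : ActionOver q G) (hπ : IsBlowup π I) {r' : V' ⟶ Y} (ρ' : ActionOver r' G) (hr' : r' = π ≫ q)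
  (hcomm : ∀ g : G, (ρ'.aut g).hom ≫ π = π ≫ (ρ.aut g).hom) {p : ℕ} (g₀ : G)

variable {m : ℕ} (r : Fin m → ℕ) {B : Type u} [CommRing B] (𝒜 : (Π j : Fin m, ZMod (r j)) → AddSubgroup B) [GradedRing 𝒜] {c : ℕ}
  (f : Fin c → B) {δ : Fin c → Π j : Fin m, ZMod (r j)} (w : Fin c → ℕ) (hf : ∀ i, f i ∈ 𝒜 (δ i))

/-- **The grading of the node of the blow-up chart `D₊(b t)`**: `chartGrading` (by `ℤ × ι`) re-indexed along `consIndexEquiv`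
(`ι = Π j, ZMod (r j)` ↦ `Π j : Fin (m+1), ZMod (cons 0 r j)`). [OURS · L1 W4.5c] -/
def chartNodeGrading (dbar : ℕ) (b : ↥(𝒜 0)) (hb : b ∈ (traceFiltration 𝒜 f w).ideal dbar) :
    (Π j : Fin (m + 1), ZMod ((Fin.cons 0 r : Fin (m + 1) → ℕ) j)) → AddSubgroup (ChartRing 𝒜 f w dbar b hb) :=
  reindex (chartGrading 𝒜 f w hf dbar b hb) (consIndexEquiv r)

/-- Its graded-ring structure. -/
@[reducible] def chartNodeGradedRing (dbar : ℕ) (b : ↥(𝒜 0)) (hb : b ∈ (traceFiltration 𝒜 f w).ideal dbar) :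
    GradedRing (chartNodeGrading r 𝒜 f w hf dbar b hb) :=
  letI := chartGradedRing 𝒜 f w hf dbar b hb
  show GradedRing (reindex (chartGrading 𝒜 f w hf dbar b hb) (consIndexEquiv r)) from
    reindexGradedRing (chartGrading 𝒜 f w hf dbar b hb) (consIndexEquiv r)

include hπ hr' hcomm in
/-- ★ **The blow-up chart `V′[O, x]` over a stable affine `O`, at a section `x ∈ I(O)` fixed by `G`, is a STABLE AFFINE OPEN of any equivariant action
upstairs** (affine: a principal chart of a blow-up; affine over `Y`: through `O`; stable: `preimage_blowupChart_eq`). [OURS · L1 W4.5c] -/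
theorem exists_stable_blowupChart (hρ : ∀ g : G, I.comap (ρ.aut g).hom = I) (O : ρ.StableAffineOpens) (hO : IsAffineOpen O.1) (x : Γ(V, O.1))
    (hxI : x ∈ I.ideal ⟨O.1, hO⟩) (hfix : ∀ g : G, (ρ.aut g).hom.appLE O.1 O.1 (O.2.1 g).ge x = x) :
    ∃ O' : ρ'.StableAffineOpens, O'.1 = blowupChart π I ⟨O.1, hO⟩ x ∧ IsAffineOpen O'.1 := by
  have hWaff : IsAffineOpen (blowupChart π I ⟨O.1, hO⟩ x) := hπ.isAffineOpen_blowupChart hxI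
  have hWle : blowupChart π I ⟨O.1, hO⟩ x ≤ π ⁻¹ᵁ O.1 := blowupChart_le_preimage π I ⟨O.1, hO⟩ x
  have hstabW : ∀ g : G, (ρ'.aut g).hom ⁻¹ᵁ blowupChart π I ⟨O.1, hO⟩ x = blowupChart π I ⟨O.1, hO⟩ x := fun g =>
    preimage_blowupChart_eq (ρ'.aut g) (ρ.aut g) (hcomm g) (O.2.1 g) (hρ g) (hfix g)
  haveI : IsAffineHom ((blowupChart π I ⟨O.1, hO⟩ x).ι ≫ r') := by
    haveI : IsAffine (blowupChart π I ⟨O.1, hO⟩ x : V'.Opens) := hWaff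
    haveI : IsAffine (O.1 : V.Opens) := hO
    haveI := O.2.2
    have : (blowupChart π I ⟨O.1, hO⟩ x).ι ≫ r' = π.resLE O.1 (blowupChart π I ⟨O.1, hO⟩ x) hWle ≫ (O.1.ι ≫ q) := by
      rw [hr', ← Category.assoc, ← Scheme.Hom.resLE_comp_ι π hWle, Category.assoc]
    rw [this]
    infer_instance
  exact ⟨⟨blowupChart π I ⟨O.1, hO⟩ x, hstabW, inferInstance⟩, rfl, hWaff⟩

set_option maxHeartbeats 800000 in
include hcomm in
/-- ★★ **THE NODE OF THE BLOW-UP CHART, EXPOSED.** Centre chart `O` with node `(B, 𝒜, σ, e)` (intertwining `g₀`) and centre `(f, w)` whose degree-0 trace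
is `I^k` on `O` in degree `dbar` (`hJ'`); a σ-fixed cover element `y ∈ K_{dbar}`. Then for ANY equivariant action `ρ'` upstairs and any stable affine open
`O'` of it with `O'.1 = V′[O, e⁻¹ y]`: `Γ(V′, O') ≃ chartNodeGrading 0` by an iso `E` for which the node `(ChartRing 𝒜 f w dbar y, chartNodeGrading,
sigmaChart …)` is TAME and `E` INTERTWINES `g₀` with `sigmaChart`. [OURS · L1 W4.5c] -/
theorem exists_nodeData_blowupChart (hp : 0 < p) (O : ρ.StableAffineOpens) (hO : IsAffineOpen O.1)
    (σ : B ≃+* B) (e : Γ(V, O.1) ≃+* ↥(𝒜 0)) (htame : IsTameNode p B 𝒜 σ) (hσp : ∀ x : B, (⇑σ)^[p] x = x)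
    (hσ : ∀ t : Γ(V, O.1), ((e ((ρ.aut g₀⁻¹).hom.appLE O.1 O.1 (O.2.1 g₀⁻¹).ge t) : ↥(𝒜 0)) : B) = σ ((e t : ↥(𝒜 0)) : B))
    (hw : ∀ i, 0 < w i) (hK1 : RingTheory.Sequence.IsRegular B (List.ofFn f)) (hK1' : IsRegularRing (B ⧸ Ideal.span (Set.range f)))
    (hσJ : ∀ n : ℕ, ((weightedFiltration f w).ideal n).map (σ : B →+* B) ≤ (weightedFiltration f w).ideal n)
    {k : ℕ} (hπ' : IsBlowup π (I ^ k)) {dbar : ℕ} (hverbar : VeroneseNormalised 𝒜 f w dbar)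
    (hJ' : (I ^ k).ideal ⟨O.1, hO⟩ = ((traceFiltration 𝒜 f w).ideal dbar).comap (e : Γ(V, O.1) →+* ↥(𝒜 0)))
    (y : ↥(𝒜 0)) (hy : y ∈ (traceFiltration 𝒜 f w).ideal dbar) (hσy : σ (y : B) = y)
    (O' : ρ'.StableAffineOpens) (hO'eq : O'.1 = blowupChart π (I ^ k) ⟨O.1, hO⟩ (e.symm y)) :
    letI := chartNodeGradedRing r 𝒜 f w hf dbar y hy
    ∃ E : Γ(V', O'.1) ≃+* ↥(chartNodeGrading r 𝒜 f w hf dbar y hy 0),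
      IsTameNode p (ChartRing 𝒜 f w dbar y hy) (chartNodeGrading r 𝒜 f w hf dbar y hy) (sigmaChart 𝒜 f w dbar y hy σ hσJ hp hσp hσy) ∧
        ∀ t' : Γ(V', O'.1),
          ((E ((ρ'.aut g₀⁻¹).hom.appLE O'.1 O'.1 (O'.2.1 g₀⁻¹).ge t') : ↥(chartNodeGrading r 𝒜 f w hf dbar y hy 0)) :
              ChartRing 𝒜 f w dbar y hy) =
            sigmaChart 𝒜 f w dbar y hy σ hσJ hp hσp hσy
              ((E t' : ↥(chartNodeGrading r 𝒜 f w hf dbar y hy 0)) : ChartRing 𝒜 f w dbar y hy) := by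
  classical
  obtain ⟨O', hO'G, hO'aff⟩ := O'
  subst hO'eq
  obtain ⟨-, -, hT1, -, hσ𝒜, -⟩ := id htame
  letI := chartNodeGradedRing r 𝒜 f w hf dbar y hy
  have hxJ : e.symm y ∈ (I ^ k).ideal ⟨O.1, hO⟩ := by
    rw [hJ', Ideal.mem_comap, RingHom.coe_coe, e.apply_symm_apply]; exact hy
  have hxy : e (e.symm y) = y := e.apply_symm_apply y
  have hWle : blowupChart π (I ^ k) ⟨O.1, hO⟩ (e.symm y) ≤ π ⁻¹ᵁ O.1 := blowupChart_le_preimage π (I ^ k) ⟨O.1, hO⟩ (e.symm y)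
  -- the node data of the chart ring (Step 7 of `exists_isNodeChart_of_isCentreChart`, with the grading named)
  obtain ⟨Ψ, hΨ⟩ := exists_ringEquiv_blowupChart hπ' ⟨O.1, hO⟩ (e.symm y) hxJ
  obtain ⟨T, hT⟩ : ∃ T : HomogeneousLocalization.Away (reesGrading ((I ^ k).ideal ⟨O.1, hO⟩)) (reesT (e.symm y) hxJ) ≃+*
      HomogeneousLocalization.Away (reesGrading ((traceFiltration 𝒜 f w).ideal dbar)) (reesT y hy),
      ∀ s, T (reesChartBase (e.symm y) hxJ s) = reesChartBase y hy (e s) :=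
    ⟨awayEquiv e hJ' hxJ hy hxy, awayEquiv_reesChartBase e hJ' hxJ hy hxy⟩
  letI := chartGradedRing 𝒜 f w hf dbar y hy
  letI : GradedRing (reindex (chartGrading 𝒜 f w hf dbar y hy) (consIndexEquiv r)) :=
    reindexGradedRing (chartGrading 𝒜 f w hf dbar y hy) (consIndexEquiv r)
  let e' : HomogeneousLocalization.Away (reesGrading ((traceFiltration 𝒜 f w).ideal dbar)) (reesT y hy) ≃+*
      ↥(reindex (chartGrading 𝒜 f w hf dbar y hy) (consIndexEquiv r) 0) :=
    ((coarseChartEquiv 𝒜 f w dbar y hy).trans (subringEquivChartGradingZero 𝒜 f w hf dbar y hy hverbar)).trans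
      (gradeZeroEquivOfEq (chartGrading 𝒜 f w hf dbar y hy) (reindex (chartGrading 𝒜 f w hf dbar y hy) (consIndexEquiv r))
        (reindex_zero _ _))
  have he' : ∀ t, ((e' t : ↥(reindex (chartGrading 𝒜 f w hf dbar y hy) (consIndexEquiv r) 0)) : ChartRing 𝒜 f w dbar y hy) =
      coarseChartMap 𝒜 f w dbar y hy t :=
    fun t => rfl
  have htame' : IsTameNode p (ChartRing 𝒜 f w dbar y hy) (chartNodeGrading r 𝒜 f w hf dbar y hy) (sigmaChart 𝒜 f w dbar y hy σ hσJ hp hσp hσy) :=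
    isTameNode_reindex (chartGrading 𝒜 f w hf dbar y hy) (consIndexEquiv r) p _
      (chartRing_isTameNode 𝒜 f w hf dbar y hy σ hσJ hp hσp hσy htame hw hK1 hK1' hverbar.1)
  refine ⟨(Ψ.trans T).trans e', htame', fun t' => ?_⟩
  -- the intertwining (Step 8, with `appLE_comm_of_le` for the arbitrary equivariant action)
  have hE : ∀ u, ((((Ψ.trans T).trans e') u : ↥(reindex (chartGrading 𝒜 f w hf dbar y hy) (consIndexEquiv r) 0)) : ChartRing 𝒜 f w dbar y hy) =
      coarseChartMap 𝒜 f w dbar y hy (T (Ψ u)) := fun u => he' (T (Ψ u))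
  refine (hE _).trans (Eq.trans ?_ (congrArg (sigmaChart 𝒜 f w dbar y hy σ hσJ hp hσp hσy) (hE t').symm))
  exact intertwine 𝒜 f w dbar y hy σ hσJ hp hσp hσy hσ𝒜 e hxJ
    (π.appLE ((⟨O.1, hO⟩ : V.affineOpens) : V.Opens) (blowupChart π (I ^ k) ⟨O.1, hO⟩ (e.symm y)) hWle).hom
    ((ρ'.aut g₀⁻¹).hom.appLE (blowupChart π (I ^ k) ⟨O.1, hO⟩ (e.symm y)) (blowupChart π (I ^ k) ⟨O.1, hO⟩ (e.symm y)) (hO'G g₀⁻¹).ge).hom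
    (fun s => (ρ.aut g₀⁻¹).hom.appLE O.1 O.1 (O.2.1 g₀⁻¹).ge s)
    (fun s => appLE_comm_of_le ρ ρ' hcomm O.1 O.2.1 (blowupChart π (I ^ k) ⟨O.1, hO⟩ (e.symm y)) hO'G hWle g₀⁻¹ s)
    hσ Ψ hΨ T hT t'

include hf in
/-- **The blow-up charts at a cover generating up to radical cover `π⁻¹ O`** (Steps 3–4 of `exists_isNodeChart_of_isCentreChart`). [OURS · L1 W4.5c] -/
theorem iSup_blowupChart_eq_preimage (O : ρ.StableAffineOpens) (hO : IsAffineOpen O.1) (e : Γ(V, O.1) ≃+* ↥(𝒜 0))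
    {k : ℕ} (hπ' : IsBlowup π (I ^ k)) {dbar : ℕ} (hverbar : VeroneseNormalised 𝒜 f w dbar)
    (hJ' : (I ^ k).ideal ⟨O.1, hO⟩ = ((traceFiltration 𝒜 f w).ideal dbar).comap (e : Γ(V, O.1) →+* ↥(𝒜 0)))
    {L : ℕ} (y : Fin L → ↥(𝒜 0)) (hy : ∀ j, y j ∈ (traceFiltration 𝒜 f w).ideal dbar)
    (hrad : ∀ i : Fin c, cobordantAlgebra.u' f w i ∈ (Ideal.span (Set.range fun j => coverElement 𝒜 f w dbar (y j) (hy j))).radical) :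
    ⨆ j, blowupChart π (I ^ k) ⟨O.1, hO⟩ (e.symm (y j)) = π ⁻¹ᵁ O.1 := by
  classical
  have hb : ∀ j, e.symm (y j) ∈ (I ^ k).ideal ⟨O.1, hO⟩ := fun j => by
    rw [hJ', Ideal.mem_comap, RingHom.coe_coe, e.apply_symm_apply]; exact hy j
  have hradO : ∀ (b' : Γ(V, O.1)) (hb' : b' ∈ (I ^ k).ideal ⟨O.1, hO⟩),
      reesT b' hb' ∈ (Ideal.span (Set.range fun j => reesT (e.symm (y j)) (hb j))).radical := by
    intro b' hb'
    have hx : e b' ∈ (traceFiltration 𝒜 f w).ideal dbar := by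
      rw [hJ', Ideal.mem_comap] at hb'; exact hb'
    have h1 := reesT_mem_radical_span 𝒜 f w dbar y hy hf hverbar hrad (e b') hx
    have hJle : ((traceFiltration 𝒜 f w).ideal dbar).map (e.symm : ↥(𝒜 0) →+* Γ(V, O.1)) ≤
        (I ^ k).ideal ⟨O.1, hO⟩ := by
      rw [Ideal.map_coe, hJ', Ideal.comap_coe, Ideal.map_symm]
    have hb'' : e.symm (e b') ∈ (I ^ k).ideal ⟨O.1, hO⟩ := by rw [e.symm_apply_apply]; exact hb'
    have h2 := reesT_mem_radical_span_of_equiv e ((I ^ k).ideal ⟨O.1, hO⟩) ((traceFiltration 𝒜 f w).ideal dbar)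
      hJle y hy hb (e b') hx hb'' h1
    have key : ∀ (a : Γ(V, O.1)) (ha : a ∈ (I ^ k).ideal ⟨O.1, hO⟩), a = b' →
        reesT a ha ∈ (Ideal.span (Set.range fun j => reesT (e.symm (y j)) (hb j))).radical →
        reesT b' hb' ∈ (Ideal.span (Set.range fun j => reesT (e.symm (y j)) (hb j))).radical := by
      rintro _ _ rfl h; exact h
    exact key _ hb'' (e.symm_apply_apply b') h2
  exact IsBlowup.iSup_blowupChart_of_radical hπ' (U := ⟨O.1, hO⟩) (fun j => e.symm (y j)) hb hradO

end Centre

/-! ## Assembly on a model: ring kill data on every chart ⇒ killable over the centre chart -/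

section Model

variable {p : ℕ} {X' X₁ : Scheme.{0}} {q : X' ⟶ X₁} {G : Type} [Group G] {ρ : G →* Aut X'} {g₀ : G}

set_option maxHeartbeats 800000 in
/-- ★★ **SECOND-LEVEL RING KILL DATA GIVE KILLABILITY OVER THE CENTRE CHART, FOR EVERY MOVE.** Let `M → M′` be a move along `(𝒦, d)` (`π′` a blow-up of
`𝒦_d`, equivariant), `O` a stable affine open of `M` with EXPLICIT node `(B, 𝒜, σ, e)` (tame, intertwining `g₀`) and centre `(f, δ, w)` whose degree-0
trace is `𝒦` on `O`, `(k, dbar, y)` a σ-fixed cover of Veronese degree `dbar = d·k` generating up to radical (as produced by `exists_normalised_cover`),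
and suppose RING KILL DATA are given in every chart node `(ChartRing 𝒜 f w dbar y_j, chartNodeGrading, sigmaChart)`. Then EVERY point of `M′` over `O`
is `KillableAt`. [OURS · L1 W4.5c] -/
theorem _root_.Summit.ResolutionOfSingularities.ResolutionOfSingularities.Theorems.WildQuotientResolution.S1.GameFrame.GModel.killableAt_over_of_ringKillData
    [Finite G] (hp : 0 < p) (hG : ∀ g : G, g ∈ Subgroup.zpowers g₀) (M M' : GameFrame.GModel p q G ρ g₀)
    (𝒦 : ReesFiltration M.V) (d : ℕ) (h𝒦G : ∀ g : G, (𝒦.ideal d).comap (M.act.aut g).hom = 𝒦.ideal d)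
    (π' : M'.V ⟶ M.V) (hbl : IsBlowup π' (𝒦.ideal d)) (hr : M'.r = π' ≫ M.r)
    (hcomm : ∀ g : G, (M'.act.aut g).hom ≫ π' = π' ≫ (M.act.aut g).hom)
    (O : M.act.StableAffineOpens) (hO : IsAffineOpen O.1)
    {m : ℕ} (r : Fin m → ℕ) {B : Type} [CommRing B] (𝒜 : (Π j : Fin m, ZMod (r j)) → AddSubgroup B) [GradedRing 𝒜] (σ : B ≃+* B)
    (e : Γ(M.V, O.1) ≃+* ↥(𝒜 0)) (htame : IsTameNode p B 𝒜 σ) (hσp : ∀ x : B, (⇑σ)^[p] x = x)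
    (hσ : ∀ t : Γ(M.V, O.1), ((e ((M.act.aut g₀⁻¹).hom.appLE O.1 O.1 (O.2.1 g₀⁻¹).ge t) : ↥(𝒜 0)) : B) = σ ((e t : ↥(𝒜 0)) : B))
    {c : ℕ} (f : Fin c → B) {δ : Fin c → Π j : Fin m, ZMod (r j)} (w : Fin c → ℕ) (hf : ∀ i, f i ∈ 𝒜 (δ i)) (hw : ∀ i, 0 < w i)
    (hK1 : RingTheory.Sequence.IsRegular B (List.ofFn f)) (hK1' : IsRegularRing (B ⧸ Ideal.span (Set.range f)))
    (hσJ : ∀ n : ℕ, ((weightedFiltration f w).ideal n).map (σ : B →+* B) ≤ (weightedFiltration f w).ideal n)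
    (h𝒦O : ∀ n : ℕ, (𝒦.filtration ⟨O.1, hO⟩).ideal n = ((traceFiltration 𝒜 f w).ideal n).comap (e : Γ(M.V, O.1) →+* ↥(𝒜 0)))
    (hver : VeroneseNormalised 𝒜 f w d)
    {k : ℕ} (hk0 : k ≠ 0) {L : ℕ} (y : Fin L → ↥(𝒜 0)) (hy : ∀ j, y j ∈ (traceFiltration 𝒜 f w).ideal (d * k))
    (hσy : ∀ j, σ (y j : B) = y j)
    (hrad : ∀ i : Fin c, cobordantAlgebra.u' f w i ∈ (Ideal.span (Set.range fun j => coverElement 𝒜 f w (d * k) (y j) (hy j))).radical)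
    (hdata : ∀ j : Fin L, letI := chartNodeGradedRing r 𝒜 f w hf (d * k) (y j) (hy j)
      RingKillData p (Fin.cons 0 r : Fin (m + 1) → ℕ) (ChartRing 𝒜 f w (d * k) (y j) (hy j)) (chartNodeGrading r 𝒜 f w hf (d * k) (y j) (hy j))
        (sigmaChart 𝒜 f w (d * k) (y j) (hy j) σ hσJ hp hσp (hσy j)))
    (v' : M'.V) (hv' : π'.base v' ∈ O.1) : M'.KillableAt v' := by
  classical
  have hverbar : VeroneseNormalised 𝒜 f w (d * k) := veroneseNormalised_mul 𝒜 f w hver (Nat.pos_of_ne_zero hk0)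
  -- `π'` blows up `(𝒦_d)^k`, whose sections over `O` are `e⁻¹ K_{dk}`
  have hπ' : IsBlowup π' ((𝒦.ideal d) ^ k) := isBlowup_pow hbl hk0
  have hJ' : ((𝒦.ideal d) ^ k).ideal ⟨O.1, hO⟩ = ((traceFiltration 𝒜 f w).ideal (d * k)).comap (e : Γ(M.V, O.1) →+* ↥(𝒜 0)) := by
    rw [Scheme.IdealSheafData.ideal_pow, Pi.pow_apply, ← ReesFiltration.filtration_ideal, h𝒦O d, hver.2 k, comap_equiv_pow]
  -- locate `v'` in a chart `W_j`
  have hcovW := iSup_blowupChart_eq_preimage (I := 𝒦.ideal d) M.act r 𝒜 f w hf O hO e hπ' hverbar hJ' y hy hrad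
  have hv'W : v' ∈ ⨆ j, blowupChart π' ((𝒦.ideal d) ^ k) ⟨O.1, hO⟩ (e.symm (y j)) := by rw [hcovW]; exact hv'
  obtain ⟨j, hj⟩ := Opens.mem_iSup.mp hv'W
  -- the chart `W_j` is a stable affine open of `M'`
  have hxJ : e.symm (y j) ∈ ((𝒦.ideal d) ^ k).ideal ⟨O.1, hO⟩ := by
    rw [hJ', Ideal.mem_comap, RingHom.coe_coe, e.apply_symm_apply]; exact hy j
  have hfix₀ : (M.act.aut g₀⁻¹).hom.appLE O.1 O.1 (O.2.1 g₀⁻¹).ge (e.symm (y j)) = e.symm (y j) := by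
    apply e.injective
    apply Subtype.ext
    rw [hσ (e.symm (y j)), e.apply_symm_apply]
    exact hσy j
  have hfix : ∀ g : G, (M.act.aut g).hom.appLE O.1 O.1 (O.2.1 g).ge (e.symm (y j)) = e.symm (y j) := fun g =>
    appLE_aut_eq_self_of_mem_zpowers M.act O.1 O.2.1 hfix₀ (by rw [Subgroup.zpowers_inv]; exact hG g)
  have hρk : ∀ g : G, ((𝒦.ideal d) ^ k).comap (M.act.aut g).hom = (𝒦.ideal d) ^ k := fun g => by rw [comap_pow, h𝒦G g]
  obtain ⟨O', hO'eq, hO'aff⟩ := exists_stable_blowupChart M.act hπ' M'.act hr hcomm hρk O hO (e.symm (y j)) hxJ hfix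
  -- its node, exposed; and the principal chart data from the ring kill data
  letI := chartNodeGradedRing r 𝒜 f w hf (d * k) (y j) (hy j)
  obtain ⟨E, htame', hE⟩ := exists_nodeData_blowupChart M.act M'.act hcomm g₀ r 𝒜 f w hf hp O hO σ e htame hσp hσ hw hK1 hK1' hσJ hπ' hverbar hJ'
    (y j) (hy j) (hσy j) O' hO'eq
  obtain ⟨d', hchart⟩ := isPrincipalChartData_of_ringKillData (ρ := M'.act) (g₀ := g₀) hO'aff (Fin.cons 0 r : Fin (m + 1) → ℕ)
    (ChartRing 𝒜 f w (d * k) (y j) (hy j)) (chartNodeGrading r 𝒜 f w hf (d * k) (y j) (hy j))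
    (sigmaChart 𝒜 f w (d * k) (y j) (hy j) σ hσJ hp hσp (hσy j)) E htame' hE (hdata j)
  exact M'.killableAt_of_chartData hchart (by rw [hO'eq]; exact hj)

end Model

end Summit.ResolutionOfSingularities.ResolutionOfSingularities.Theorems.WildQuotientResolution.S1.BlowupCharts

end
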